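import Literature.MathematicalPhysics.QuantumFieldTheory.Balaban1983to89.T4DobrushinTensorisation
import HarnessLib

/-!
# The Gibbs law and the one-site Gibbs kernels of `T4DobrushinTensorisation` §7 are TILTED measures

[topic MathematicalPhysics/QuantumFieldTheory]

`T4DobrushinTensorisation.lean` §7 defines, for a product reference law `⊗ᵢ πᵢ` and an energy `A`
on `Π i, E i`, the Gibbs law `gibbsMeasure π A = e^{−A} d(⊗πᵢ) / Z` and the one-site heat-bath
kernels `gibbsKernel π A i ξ (dy) = e^{−A(ξ[i ↦ y])} πᵢ(dy) / Zᵢ(ξ)`. This file records that they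
ARE Mathlib's exponentially tilted measures, `(⊗ πᵢ).tilted (−A)` and
`πᵢ.tilted (y ↦ −A(ξ[i ↦ y]))` — the finite-volume Gibbs distribution relative to a (product)
reference measure, «`π_Λ^Φ(A | η) = (Z_Λ^η)⁻¹ ∫ 𝟙_A(ω_Λ η_{Λᶜ}) e^{−H_{Λ;Φ}(ω_Λ η_{Λᶜ})} λ₀^Λ(dω_Λ)`»
(Friedli–Velenik (6.110)), in the volumes `Λ = ι` and `Λ = {i}`. The identities are definitional
unfoldings; their purpose is to let files phrased with `Measure.tilted` — e.g. tilted Haar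
product measures of lattice gauge theory (`weightMeasure φ = (⊗ Haar).tilted φ`) and their one-link
conditional laws (`siteLaw (weightSpec φ) e ω = Haar.tilted (g ↦ φ(ω^{e ← g}))`,
`StrongCouplingOpenWindow.siteLaw_weightSpec_eq_tilted`) — use the DLR identities
(`resamplingInvariant_gibbs`), the Feller continuity (`T4GibbsKernelFeller`) and the Dobrushin
coupling theorems (`Probability/TransportMaps/DobrushinCouplingGibbs*`) proved for
`gibbsMeasure` / `gibbsKernel`; the sign convention of §7 is `e^{−A}`, so `A = −φ`
(`gibbsMeasure_neg_eq_tilted`, `gibbsKernel_neg_eq_tilted`).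

## References
* S. Friedli, Y. Velenik, *Statistical Mechanics of Lattice Systems* (CUP 2017), §6.10.2, eq.
  (6.110) (the Gibbsian specification relative to a reference measure `λ₀`). [FriedliVelenik2017]
-/

noncomputable section

open MeasureTheory ProbabilityTheory Function

namespace Literature.MathematicalPhysics.QuantumFieldTheory.Balaban1983to89.T4DobrushinTensorisation

universe u v

variable {ι : Type u} {E : ι → Type v} [∀ i, MeasurableSpace (E i)]
variable {π : (i : ι) → Measure (E i)} {A : ((j : ι) → E j) → ℝ}

/-- **The Gibbs law is the tilted product measure**: `gibbsMeasure π A = (⊗ᵢ πᵢ).tilted (−A)`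
(`e^{−A} d(⊗πᵢ) / Z`, the finite-volume Gibbs distribution relative to the product reference
measure, volume `Λ = ι`). [cite: FriedliVelenik2017, §6.10.2 (6.110)] -/
theorem gibbsMeasure_eq_tilted [Fintype ι] :
    gibbsMeasure π A = (Measure.pi π).tilted fun ξ => -A ξ := rfl

/-- The same for an energy written with the opposite sign convention (`e^{+φ}`):
`gibbsMeasure π (−φ) = (⊗ᵢ πᵢ).tilted φ`. [cite: FriedliVelenik2017, §6.10.2 (6.110)] -/
theorem gibbsMeasure_neg_eq_tilted [Fintype ι] (φ : ((j : ι) → E j) → ℝ) :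
    gibbsMeasure π (fun ξ => -φ ξ) = (Measure.pi π).tilted φ := by
  rw [gibbsMeasure_eq_tilted]
  simp only [neg_neg]

variable [DecidableEq ι] [∀ i, IsProbabilityMeasure (π i)]

/-- **The one-site Gibbs kernel is the tilted single-spin reference measure**:
`gibbsKernel π A i ξ = πᵢ.tilted (y ↦ −A(ξ[i ↦ y]))` (the volume-`{i}` case of (6.110)).
[cite: FriedliVelenik2017, §6.10.2 (6.110)] -/
theorem gibbsKernel_eq_tilted (hAm : Measurable A) (i : ι) (ξ : (j : ι) → E j) :
    gibbsKernel π A i ξ = (π i).tilted fun y => -A (update ξ i y) := by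
  rw [gibbsKernel_apply hAm]
  rfl

/-- The same with the opposite sign convention: `gibbsKernel π (−φ) i ξ = πᵢ.tilted (y ↦ φ(ξ[i ↦ y]))`
(e.g. the one-link law `Haar.tilted (g ↦ φ(ω^{e ← g}))` of a tilted Haar product measure).
[cite: FriedliVelenik2017, §6.10.2 (6.110)] -/
theorem gibbsKernel_neg_eq_tilted {φ : ((j : ι) → E j) → ℝ} (hφm : Measurable φ) (i : ι)
    (ξ : (j : ι) → E j) :
    gibbsKernel π (fun ζ => -φ ζ) i ξ = (π i).tilted fun y => φ (update ξ i y) := by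
  have hm : Measurable fun ζ : (j : ι) → E j => -φ ζ := hφm.neg
  rw [gibbsKernel_eq_tilted (A := fun ζ => -φ ζ) hm i ξ]
  simp only [neg_neg]

end Literature.MathematicalPhysics.QuantumFieldTheory.Balaban1983to89.T4DobrushinTensorisation

end
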